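import Literature.NumberTheory.Automorphic.QuaternionAdelicUnitsPlaceSplitting
import Literature.MeasureTheory.Group.InvariantQuotientOrbitalProd
import HarnessLib

/-!
# Gelbart's (10.19) on the `Dˣ` side at one finite place: orbital integrals of factorizable test
# functions on `D_𝔸ˣ` factor through `D_𝔸ˣ = D_vˣ × D^{(v),×}`
(Gelbart, *Automorphic forms on adele groups* (1975), §10, pp. 153–155, (10.14), (10.19))

Topic `NumberTheory/Automorphic`; theorems only (no definition, no named fact, no instance visible
to importers). The `Dˣ`-side twin of `GLnPlaceSplittingCentralizer`.

Gelbart (1975), p. 154, treats the geometric side (10.14) for `G' = Dˣ` exactly like (10.15) for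
`G = GL₂` ("Now we deal similarly with (10.15)", p. 155): for a factorizable test function
`Φ' = f'_v ⊗ Φ'^{(v)}` the orbital integral `∫_{B'_𝔸 \ G'_𝔸} Φ'(x⁻¹ γ x) dx` is the product of the
local factor at `v` and the factor away from `v` ((10.19) with primes). With the tree's splitting
`Quat.placeSplitting K D v : D_vˣ × D^{(v),×} ≃ₜ* D_𝔸ˣ` (`QuaternionAdelicUnitsPlaceSplitting`;
`D^{(v),×} = ker(x ↦ x_v)`) and the abstract factorisation
`Literature.MeasureTheory.Group.exists_integral_descConj_eq_smul_mul` (`InvariantQuotientOrbitalProd`):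

* `Quat.ofLocal_mul_comm_of_mem_ker` (`ι_v(D_vˣ)` commutes with `D^{(v),×}`),
  `Quat.toCompletionUnits_posRealCentral`, `Quat.posRealCentral_mem_ker`,
  `Quat.center'_le_ker_toCompletionUnits` — **the split centre `A_{G'} = ℝ_{>0}` lies in `D^{(v),×}`**,
  `Quat.placeSplitting_symm_posRealCentral`;
* `Quat.mem_centralizer_iff_placeSplitting_symm`, `Quat.map_placeSplitting_symm_centralizer`,
  `Quat.map_placeSplitting_centralizer_prod` — **centralisers split**: `splitting⁻¹(C(γ)) =
  C_{D_vˣ}(γ_v) × C_{D^{(v),×}}(s γ)` (Gelbart p. 154: `B'_𝔸 = B'_v × B'^{(v)}` for the tori);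
* `Quat.integral_mul_eq_smul_integral_mul_integral` — factorizable integrands factor against
  `(splitting⁻¹)_* ν = κ • (μ_v ⊗ μ')` (`Quat.exists_map_placeSplitting_symm_eq_smul_prod`);
* `Quat.exists_integral_descConj_eq_smul_mul` — **(10.19)' at `v`**: for `γ ∈ D_𝔸ˣ` with closed
  centralisers of its components and non-zero invariant measures finite on compact sets on the three
  coset spaces there is one `c ≠ 0` with
  `∫_{D_𝔸ˣ/C(γ)} Φ(y γ y⁻¹) dμ = c (∫_{D_vˣ/C(γ_v)} ξ(a γ_v a⁻¹) dμ_v)(∫_{D^{(v),×}/C(sγ)} Θ(k (sγ) k⁻¹) dμ')`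
  for every `Φ` factorizable at `v`, `Φ(ι_v(a) k) = ξ(a) Θ(k)`.

Statements are on the types `adelicUnits K D`, `completionUnits D v` of `QuaternionAlgebraAdelic`
(= `(AdelicGroupData.units K D).Adelic`, `.Local v` definitionally); the local compactness and
second countability of `D_vˣ` and the Borel structures are instance hypotheses, as for `GL_n(K_v)` in
the `GL_n` twin. Part of the inline (D-0026) decomposition of
`Literature.NumberTheory.Automorphic.strong_multiplicity_one_quaternionUnits`.

## References

* S. Gelbart, *Automorphic forms on adele groups*, Ann. of Math. Studies 83 (1975), §10,
  pp. 153–155, (10.14), (10.19) [Gelbart1975].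
* D. Bump, *Automorphic Forms and Representations* (1997), §3.3, Prop. 3.3.2 [Bump1997].
-/

noncomputable section

open MeasureTheory MeasureTheory.Measure NumberField IsDedekindDomain
open scoped NNReal ENNReal

universe u

namespace Literature.NumberTheory.Automorphic

open Literature.MeasureTheory.Group

/-! ### `ι_v(D_vˣ)` commutes with `D^{(v),×}`; the split centre lies in `D^{(v),×}` -/

section Center

variable {K : Type} [Field K] [NumberField K] {D : Type u} [Ring D] [Algebra K D]
  {v : HeightOneSpectrum (𝓞 K)}

/-- `ι_v(t)` commutes with every `c ∈ D^{(v),×} = ker (x ↦ x_v)`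
(`Quat.ofLocal_mul_eq_mul_ofLocal_of_toCompletionUnits_eq_one`). [folklore] -/
theorem Quat.ofLocal_mul_comm_of_mem_ker {c : adelicUnits K D} (hc : c ∈ (toCompletionUnits K D v).ker)
    (t : completionUnits D v) : Quat.ofLocal K D v t * c = c * Quat.ofLocal K D v t :=
  Quat.ofLocal_mul_eq_mul_ofLocal_of_toCompletionUnits_eq_one t (MonoidHom.mem_ker.1 hc)

/-- **The `v`-component of `z(t) ⊗ 1 ∈ A_{G'}` is `1`** (the idele `z(t)` is trivial at the finite
places, `posRealIdele_snd`). [folklore] -/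
theorem Quat.toCompletionUnits_posRealCentral (t : ℝ≥0ˣ) :
    toCompletionUnits K D v (posRealCentral K D t) = 1 := by
  refine Units.ext ?_
  change ScalarExtension.mapLeft K D (adeleEvalAlgHom K v)
      (algebraMap (AdeleRing (𝓞 K) K) (ScalarExtension K (AdeleRing (𝓞 K) K) D)
        ((posRealIdele K t : (AdeleRing (𝓞 K) K)ˣ) : AdeleRing (𝓞 K) K)) = 1
  rw [ScalarExtension.mapLeft_algebraMap, adeleEvalAlgHom_apply, posRealIdele_snd]
  exact map_one (algebraMap (v.adicCompletion K) (ScalarExtension K (v.adicCompletion K) D))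

/-- The positive real central elements lie in `D^{(v),×}`. [folklore] -/
theorem Quat.posRealCentral_mem_ker (t : ℝ≥0ˣ) : posRealCentral K D t ∈ (toCompletionUnits K D v).ker :=
  MonoidHom.mem_ker.2 (Quat.toCompletionUnits_posRealCentral t)

variable (K D v) in
/-- **`A_{G'} = ℝ_{>0} ≤ D^{(v),×}`**: the split centre `(units K D).center'` of the adelic datum is
contained in the kernel of `x ↦ x_v` (so the central average of a product test function
`ξ_v ⊗ θ^{(v)}` is `ξ_v ⊗ θ^{(v)}_A`). [folklore] -/
theorem Quat.center'_le_ker_toCompletionUnits [Module.Finite K D] :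
    (AdelicGroupData.units K D).center' ≤ (toCompletionUnits K D v).ker := by
  rintro _ ⟨t, rfl⟩
  exact Quat.posRealCentral_mem_ker t

/-- The splitting of a positive real central element: `splitting⁻¹(z(t)) = (1, z(t))`. [folklore] -/
theorem Quat.placeSplitting_symm_posRealCentral [Module.Finite K D] (t : ℝ≥0ˣ) :
    (Quat.placeSplitting K D v).symm (posRealCentral K D t) =
      (1, ⟨posRealCentral K D t, Quat.posRealCentral_mem_ker t⟩) :=
  Prod.ext (Quat.toCompletionUnits_posRealCentral t)
    (Subtype.ext (Quat.awayFrom_eq_self_of_mem_ker (Quat.posRealCentral_mem_ker t)))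

end Center

/-! ### Centralisers split -/

section Centralizer

variable {K : Type} [Field K] [NumberField K] {D : Type u} [Ring D] [Algebra K D] [Module.Finite K D]
  {v : HeightOneSpectrum (𝓞 K)}

/-- **Centralisers split** (Gelbart (1975), p. 154: `B'_𝔸 = B'_v × B'^{(v)}` for the tori of (10.19)'):
`h ∈ C(g)` iff `h_v ∈ C_{D_vˣ}(g_v)` and `s(h) ∈ C_{D^{(v),×}}(s(g))`, the components being those of
`splitting⁻¹ = (x ↦ x_v, s)`. [cite: Gelbart1975, p. 155 (10.19)] -/
theorem Quat.mem_centralizer_iff_placeSplitting_symm (g h : adelicUnits K D) :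
    h ∈ Subgroup.centralizer ({g} : Set (adelicUnits K D)) ↔
      toCompletionUnits K D v h ∈ Subgroup.centralizer ({toCompletionUnits K D v g} : Set (completionUnits D v)) ∧
        ((Quat.placeSplitting K D v).symm h).2 ∈
          Subgroup.centralizer ({((Quat.placeSplitting K D v).symm g).2} : Set (toCompletionUnits K D v).ker) := by
  rw [← mulEquiv_apply_mem_centralizer_singleton_iff (Quat.placeSplitting K D v).symm.toMulEquiv g h]
  change (Quat.placeSplitting K D v).symm h ∈ Subgroup.centralizer {(Quat.placeSplitting K D v).symm g} ↔ _
  rw [show (Quat.placeSplitting K D v).symm g =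
      (((Quat.placeSplitting K D v).symm g).1, ((Quat.placeSplitting K D v).symm g).2) from rfl,
    centralizer_singleton_prod_eq, Subgroup.mem_prod]
  rfl

/-- **The image of a centraliser under the splitting**: `splitting⁻¹(C(g)) = C_{D_vˣ}(g_v) × C_{D^{(v),×}}(s g)`.
[cite: Gelbart1975, p. 155 (10.19)] -/
theorem Quat.map_placeSplitting_symm_centralizer (g : adelicUnits K D) :
    (Subgroup.centralizer ({g} : Set (adelicUnits K D))).map
        (Quat.placeSplitting K D v).symm.toMulEquiv.toMonoidHom =
      (Subgroup.centralizer ({toCompletionUnits K D v g} : Set (completionUnits D v))).prod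
        (Subgroup.centralizer ({((Quat.placeSplitting K D v).symm g).2} : Set (toCompletionUnits K D v).ker)) := by
  ext p
  rw [Subgroup.mem_map]
  constructor
  · rintro ⟨h, hh, rfl⟩
    exact (Subgroup.mem_prod).2 ((Quat.mem_centralizer_iff_placeSplitting_symm g h).1 hh)
  · intro hp
    refine ⟨Quat.placeSplitting K D v p, ?_, (Quat.placeSplitting K D v).symm_apply_apply p⟩
    have h1 : (Quat.placeSplitting K D v).symm (Quat.placeSplitting K D v p) = p :=
      (Quat.placeSplitting K D v).symm_apply_apply p
    have h2 := (Quat.mem_centralizer_iff_placeSplitting_symm (v := v) g (Quat.placeSplitting K D v p)).2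
    rw [show toCompletionUnits K D v (Quat.placeSplitting K D v p) = p.1 from congrArg Prod.fst h1,
      show ((Quat.placeSplitting K D v).symm (Quat.placeSplitting K D v p)).2 = p.2 from congrArg Prod.snd h1] at h2
    exact h2 ((Subgroup.mem_prod).1 hp)

/-- The same for the preimage: `splitting(C_{D_vˣ}(g_v) × C_{D^{(v),×}}(s g)) = C(g)`.
[cite: Gelbart1975, p. 155 (10.19)] -/
theorem Quat.map_placeSplitting_centralizer_prod (g : adelicUnits K D) :
    ((Subgroup.centralizer ({toCompletionUnits K D v g} : Set (completionUnits D v))).prod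
        (Subgroup.centralizer ({((Quat.placeSplitting K D v).symm g).2} : Set (toCompletionUnits K D v).ker))).map
        (Quat.placeSplitting K D v).toMulEquiv.toMonoidHom =
      Subgroup.centralizer ({g} : Set (adelicUnits K D)) := by
  rw [← Quat.map_placeSplitting_symm_centralizer (v := v) g, Subgroup.map_map]
  convert Subgroup.map_id _
  exact MonoidHom.ext fun x => (Quat.placeSplitting K D v).apply_symm_apply x

end Centralizer

/-! ### Factorizable integrands factor -/

section Haar

variable {K : Type} [Field K] [NumberField K] {D : Type u} [Ring D] [Algebra K D] [Module.Finite K D]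
  {v : HeightOneSpectrum (𝓞 K)}

/-- **Factorizable integrands factor** (Bump (1997), Prop. 3.3.2; the mechanism of (10.19)'): if
`(splitting⁻¹)_* ν = κ • (μ_v ⊗ μ')` (`Quat.exists_map_placeSplitting_symm_eq_smul_prod`) then for all
complex `ξ` on `D_vˣ` and `θ` on `D^{(v),×}`,
`∫_{D_𝔸ˣ} ξ(x_v) θ(s x) dν(x) = κ (∫ ξ dμ_v) (∫ θ dμ')` (no integrability needed).
[cite: Bump1997, §3.3 Prop. 3.3.2] [cite: Gelbart1975, p. 155 (10.19)] -/
theorem Quat.integral_mul_eq_smul_integral_mul_integral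
    [MeasurableSpace (adelicUnits K D)] [BorelSpace (adelicUnits K D)]
    [MeasurableSpace (completionUnits D v)] [BorelSpace (completionUnits D v)]
    [SecondCountableTopology (completionUnits D v)]
    (ν : Measure (adelicUnits K D)) (μv : Measure (completionUnits D v))
    (μ' : Measure ((toCompletionUnits K D v).ker : Subgroup (adelicUnits K D)))
    [SFinite μv] [SFinite μ'] {κ : ℝ≥0}
    (hmap : Measure.map (Quat.placeSplitting K D v).symm ν = κ • μv.prod μ')
    (ξ : completionUnits D v → ℂ) (θ : (toCompletionUnits K D v).ker → ℂ) :
    ∫ x, ξ (toCompletionUnits K D v x) * θ ((Quat.placeSplitting K D v).symm x).2 ∂ν =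
      κ • ((∫ t, ξ t ∂μv) * ∫ c, θ c ∂μ') := by
  haveI : T2Space (AdeleRing (𝓞 K) K) := t2Space_adeleRing K
  haveI : T2Space (adelicUnits K D) := inferInstance
  haveI : BorelSpace ((toCompletionUnits K D v).ker : Subgroup (adelicUnits K D)) := Subtype.borelSpace _
  haveI : BorelSpace (completionUnits D v × ((toCompletionUnits K D v).ker : Subgroup (adelicUnits K D))) :=
    Prod.borelSpace
  set e := (Quat.placeSplitting K D v).symm with he
  let em : adelicUnits K D ≃ᵐ completionUnits D v × ((toCompletionUnits K D v).ker : Subgroup (adelicUnits K D)) :=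
    e.toHomeomorph.toMeasurableEquiv
  have hem : ∀ x, em x = e x := fun _ => rfl
  have hmap' : Measure.map em ν = κ • μv.prod μ' := hmap
  have h1 := integral_map_equiv (μ := ν) em (fun p => ξ p.1 * θ p.2)
  simp only [hem] at h1
  change ∫ x, ξ (e x).1 * θ (e x).2 ∂ν = _
  rw [← h1, hmap', integral_smul_nnreal_measure, integral_prod_mul]

end Haar

/-! ### (10.19)' at one finite place: orbital integrals of factorizable functions on `D_𝔸ˣ` factor -/

section Orbital

variable {K : Type} [Field K] [NumberField K] {D : Type u} [Ring D] [Algebra K D] [Module.Finite K D]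
  {v : HeightOneSpectrum (𝓞 K)}

/-- **Gelbart's (10.19) on the `Dˣ` side at one finite place `v`**: for `γ ∈ D_𝔸ˣ` with components
`γ_v ∈ D_vˣ` and `γ^{(v)} = s(γ) ∈ D^{(v),×}` whose centralisers `B'_v = C_{D_vˣ}(γ_v)` and
`B'^{(v)} = C_{D^{(v),×}}(γ^{(v)})` are closed, and non-zero invariant measures `μ`, `μ_v`, `μ'` on
`D_𝔸ˣ ⧸ C(γ)`, `D_vˣ ⧸ B'_v`, `D^{(v),×} ⧸ B'^{(v)}` finite on compact sets, there is one `c ≠ 0` such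
that for every factorizable `Φ` — `Φ(ι_v(a) k) = ξ(a) Θ(k)` for `a ∈ D_vˣ`, `k ∈ D^{(v),×}` — the orbital
integral factors:
`∫_{D_𝔸ˣ/C(γ)} Φ(y γ y⁻¹) dμ = c (∫_{D_vˣ/B'_v} ξ(a γ_v a⁻¹) dμ_v)(∫_{D^{(v),×}/B'^{(v)}} Θ(k γ^{(v)} k⁻¹) dμ')`
("`∫_{B'_𝔸 \ G'_𝔸} Φ'(x⁻¹ γ x) dx` is the product of the local integral at `v` and the integral away
from `v`", left cosets, `y = x⁻¹`; `exists_integral_descConj_eq_smul_mul` of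
`InvariantQuotientOrbitalProd` for the splitting `Quat.placeSplitting K D v`). [cite: Gelbart1975, pp. 154–155 (10.14), (10.19)] -/
theorem Quat.exists_integral_descConj_eq_smul_mul
    [MeasurableSpace (completionUnits D v)] [BorelSpace (completionUnits D v)]
    [SecondCountableTopology (completionUnits D v)] [LocallyCompactSpace (completionUnits D v)]
    (γ : adelicUnits K D)
    (hC₁ : IsClosed ((Subgroup.centralizer ({toCompletionUnits K D v γ} : Set (completionUnits D v)) :
      Set (completionUnits D v))))
    (hC₂ : IsClosed ((Subgroup.centralizer ({((Quat.placeSplitting K D v).symm γ).2} :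
      Set (toCompletionUnits K D v).ker)) : Set (toCompletionUnits K D v).ker))
    [MeasurableSpace (adelicUnits K D ⧸ Subgroup.centralizer ({γ} : Set (adelicUnits K D)))]
    [BorelSpace (adelicUnits K D ⧸ Subgroup.centralizer ({γ} : Set (adelicUnits K D)))]
    [MeasurableSpace (completionUnits D v ⧸
      Subgroup.centralizer ({toCompletionUnits K D v γ} : Set (completionUnits D v)))]
    [BorelSpace (completionUnits D v ⧸
      Subgroup.centralizer ({toCompletionUnits K D v γ} : Set (completionUnits D v)))]
    [MeasurableSpace ((toCompletionUnits K D v).ker ⧸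
      Subgroup.centralizer ({((Quat.placeSplitting K D v).symm γ).2} : Set (toCompletionUnits K D v).ker))]
    [BorelSpace ((toCompletionUnits K D v).ker ⧸
      Subgroup.centralizer ({((Quat.placeSplitting K D v).symm γ).2} : Set (toCompletionUnits K D v).ker))]
    (μ : Measure (adelicUnits K D ⧸ Subgroup.centralizer ({γ} : Set (adelicUnits K D))))
    [SMulInvariantMeasure (adelicUnits K D) _ μ] [IsFiniteMeasureOnCompacts μ]
    (μv : Measure (completionUnits D v ⧸
      Subgroup.centralizer ({toCompletionUnits K D v γ} : Set (completionUnits D v))))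
    [SMulInvariantMeasure (completionUnits D v) _ μv] [IsFiniteMeasureOnCompacts μv] [SFinite μv]
    (μ' : Measure ((toCompletionUnits K D v).ker ⧸
      Subgroup.centralizer ({((Quat.placeSplitting K D v).symm γ).2} : Set (toCompletionUnits K D v).ker)))
    [SMulInvariantMeasure (toCompletionUnits K D v).ker _ μ'] [IsFiniteMeasureOnCompacts μ'] [SFinite μ']
    (hμ : μ ≠ 0) (hv : μv ≠ 0) (h' : μ' ≠ 0) :
    ∃ c : ℝ≥0, c ≠ 0 ∧ ∀ (Φ : adelicUnits K D → ℂ) (ξ : completionUnits D v → ℂ)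
      (Θ : (toCompletionUnits K D v).ker → ℂ),
      (∀ (a : completionUnits D v) (k : (toCompletionUnits K D v).ker),
          Φ (Quat.ofLocal K D v a * (k : adelicUnits K D)) = ξ a * Θ k) →
        ∫ y, descConj γ (Subgroup.centralizer ({γ} : Set (adelicUnits K D)))
            (Literature.MeasureTheory.Group.centralizer_comm γ) Φ y ∂μ =
          c • ((∫ x, descConj (toCompletionUnits K D v γ) _ (Literature.MeasureTheory.Group.centralizer_comm _) ξ x ∂μv) *
            ∫ x, descConj ((Quat.placeSplitting K D v).symm γ).2 _
              (Literature.MeasureTheory.Group.centralizer_comm _) Θ x ∂μ') := by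
  haveI : LocallyCompactSpace (AdeleRing (𝓞 K) K) := locallyCompactSpace_adeleRing' K
  haveI : T2Space (AdeleRing (𝓞 K) K) := t2Space_adeleRing K
  haveI : LocallyCompactSpace (adelicUnits K D) := inferInstance
  haveI : T2Space (adelicUnits K D) := inferInstance
  haveI : SecondCountableTopology (adelicUnits K D) := by
    haveI := secondCountableTopology_adeleRing K
    haveI : SecondCountableTopology (ScalarExtension K (AdeleRing (𝓞 K) K) D) :=
      (ScalarExtension.coordHomeomorph K (AdeleRing (𝓞 K) K) D).secondCountableTopology
    haveI : SecondCountableTopology (ScalarExtension K (AdeleRing (𝓞 K) K) D)ᵐᵒᵖ :=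
      MulOpposite.opHomeomorph.symm.secondCountableTopology
    exact Units.isEmbedding_embedProduct.secondCountableTopology
  haveI : T2Space (completionUnits D v) := inferInstance
  haveI : SecondCountableTopology ((toCompletionUnits K D v).ker : Subgroup (adelicUnits K D)) :=
    TopologicalSpace.Subtype.secondCountableTopology _
  haveI : LocallyCompactSpace ((toCompletionUnits K D v).ker : Subgroup (adelicUnits K D)) :=
    (Quat.isClosed_ker_toCompletionUnits K D v).isClosedEmbedding_subtypeVal.locallyCompactSpace
  have hγ : (Quat.placeSplitting K D v).toMulEquiv
      (toCompletionUnits K D v γ, ((Quat.placeSplitting K D v).symm γ).2) = γ :=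
    (Quat.placeSplitting K D v).apply_symm_apply γ
  exact Literature.MeasureTheory.Group.exists_integral_descConj_eq_smul_mul
    (Quat.placeSplitting K D v).toMulEquiv (Quat.placeSplitting K D v).continuous
    (Quat.placeSplitting K D v).symm.continuous hγ hC₁ hC₂ μ μv μ' hμ hv h'

end Orbital

end Literature.NumberTheory.Automorphic
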